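import Summits.QuantumFields.YangMills.Theorems.ScalingWindowSplitSelfNormalisedSkewnessWitnessAsymptotics
import HarnessLib

/-!
# `SelfNormalisedSkewness` (W₂ of route `ScalingWindowSplit`) is false as typed — the `U(1)` witness

Route `ScalingWindowSplit`, crux `stmt-QuantumFields-18944`, line `Sketch` (negation branch): the closing file.
Along the super-weak `U(1)` scheme `(u1LatticeRep, swScheme 96, bumpU, p = 201, M)` every hypothesis of the
crux holds (weak coupling `β_k = (k+1)^{96} → ∞`, polynomial volumes with `N = 1`, past support of the bump,
floor `a_k^{201} ≤ T_k(u)` and window `T_k(u) ≤ M T_k(τ₋₁u)` eventually — `T_k` is of exact order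
`a_k⁸β_k⁻² = (k+1)^{-200}`), while for every pairwise disjoint Schwartz triple the self-normalised third
cumulant is `O((k+1)^{-1/2}) → 0`.  This INHABITS the hypothesis `MaxwellDominatedWindowScheme` of the
disprover's negative lemma (`maxwellDominatedWindowScheme_holds`), whence `not_SelfNormalisedSkewness`.
Class: refuted-misstated; repair `C′`: insert `0 < Δ → HasLatticeMassGap r sch Δ →` after
`sch.HasWeakCouplingLimit →` (the Coulomb-phase witness has no volume-uniform physical gap).

References: Lüscher 1999 §3; Guth 1980; Fröhlich–Spencer 1982 (context only).  No named facts are used: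
everything is proved from the tree.
-/

noncomputable section

open scoped BigOperators ENNReal InnerProductSpace
open MeasureTheory ProbabilityTheory Filter Topology
open Literature.MathematicalPhysics.QuantumLattice Literature.MathematicalPhysics.QuantumFieldTheory
open Literature.Probability.LatticeModels (box)

namespace Summit.QuantumFields.YangMills.Theorems.SelfNormalisedSkewness.Negative

/-! ### Elementary rates -/

/-- `1 + log(2n² + 1) ≤ 7√n` for `n ≥ 1`. [folklore] -/
theorem one_add_log_le (n : ℝ) (hn : 1 ≤ n) : 1 + Real.log (2 * n ^ 2 + 1) ≤ 7 * Real.sqrt n := by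
  have hn0 : 0 < n := by linarith
  have hs0 : 0 < Real.sqrt n := Real.sqrt_pos.2 hn0
  have h1 : Real.log (2 * n ^ 2 + 1) ≤ Real.log (3 * n ^ 2) :=
    Real.log_le_log (by positivity) (by nlinarith)
  have h2 : Real.log (3 * n ^ 2) = Real.log 3 + 2 * Real.log n := by
    rw [Real.log_mul (by norm_num) (by positivity), Real.log_pow]; push_cast; ring
  have h3 : Real.log 3 ≤ 2 := by linarith [Real.log_le_sub_one_of_pos (by norm_num : (0 : ℝ) < 3)]
  have h4 : Real.log n = 2 * Real.log (Real.sqrt n) := by rw [Real.log_sqrt hn0.le]; ring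
  have h5 : Real.log (Real.sqrt n) ≤ Real.sqrt n - 1 := Real.log_le_sub_one_of_pos hs0
  linarith

/-! ### The bare third moment along the scheme -/

/-- **The bare smeared third moment is `O(n^{-300} n^{-1/2})` along the scheme.** [folklore] -/
theorem cm3_witness_eventually (f g h : SchwartzMap E4 ℝ) (hfg : Disjoint (tsupport f) (tsupport g))
    (hfh : Disjoint (tsupport f) (tsupport h)) (hgh : Disjoint (tsupport g) (tsupport h)) :
    ∃ K : ℝ, 0 ≤ K ∧ ∀ᶠ k in atTop,
      |∫ U, (PhiW k f U - ∫ U', PhiW k f U' ∂(wilsonMeasure u1Rep (nR k ^ 96) :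
              Measure (GaugeConfig 4 (2 * (k + 1) ^ (2 : ℕ) + 1) Circle))) *
            (PhiW k g U - ∫ U', PhiW k g U' ∂(wilsonMeasure u1Rep (nR k ^ 96) :
              Measure (GaugeConfig 4 (2 * (k + 1) ^ (2 : ℕ) + 1) Circle))) *
            (PhiW k h U - ∫ U', PhiW k h U' ∂(wilsonMeasure u1Rep (nR k ^ 96) :
              Measure (GaugeConfig 4 (2 * (k + 1) ^ (2 : ℕ) + 1) Circle)))
          ∂(wilsonMeasure u1Rep (nR k ^ 96) : Measure (GaugeConfig 4 (2 * (k + 1) ^ (2 : ℕ) + 1) Circle))| ≤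
        K * ((nR k ^ 300)⁻¹ * (Real.sqrt (nR k))⁻¹) := by
  obtain ⟨K, hK0, hK⟩ := smeared_cm3_bound f g h hfg hfh hgh
  refine ⟨981 * K, by positivity, ?_⟩
  filter_upwards [scheme_admissible, eta_eventually_le] with k hadm hη
  obtain ⟨hSε, hw4, hτ, htail⟩ := hadm
  have hn := nR_pos k
  have hn1 := one_le_nR k
  have hb := hK ((k + 1) ^ (2 : ℕ)) ((nR k)⁻¹) (nR k ^ 96) (epsW k) (a_pos' k) (a_le_one k) (a_sq_mul_L k)
    (pow_pos hn 96) (epsK_pos k) (epsK_le_one k) hSε (one_le_eps_mul_sqrt_beta k) hw4 hτ htail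
  refine (le_of_eq ?_).trans (hb.trans ?_)
  · rfl
  -- the four error terms against `n^{-300} n^{-1/2}`
  set Q := (nR k ^ 300)⁻¹ * (Real.sqrt (nR k))⁻¹ with hQ
  have hQ0 : 0 ≤ Q := by positivity
  -- `n^{-m} ≤ (√n)⁻¹` for `m ≥ 1`
  have hs : ∀ (m : ℕ), 1 ≤ m → (nR k ^ m)⁻¹ ≤ (Real.sqrt (nR k))⁻¹ := fun m hm => by
    refine inv_anti₀ (Real.sqrt_pos.2 hn) ?_
    calc Real.sqrt (nR k) ≤ nR k := Real.sqrt_le_iff.2 ⟨hn.le, by nlinarith⟩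
      _ = nR k ^ 1 := (pow_one _).symm
      _ ≤ nR k ^ m := pow_le_pow_right₀ hn1 hm
  have t1 : (nR k)⁻¹ ^ 13 * (nR k ^ 96)⁻¹ ^ 3 * (1 + Real.log (2 * (((k + 1) ^ (2 : ℕ) : ℕ) : ℝ) + 1)) ≤ 7 * Q := by
    have hl : 1 + Real.log (2 * (((k + 1) ^ (2 : ℕ) : ℕ) : ℝ) + 1) ≤ 7 * Real.sqrt (nR k) := by
      have := one_add_log_le (nR k) hn1
      rw [nR_eq_cast] at this ⊢; push_cast at this ⊢; exact this
    have e : (nR k)⁻¹ ^ 13 * (nR k ^ 96)⁻¹ ^ 3 * (7 * Real.sqrt (nR k)) = 7 * Q := by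
      rw [hQ]
      have hsq : Real.sqrt (nR k) * Real.sqrt (nR k) = nR k := Real.mul_self_sqrt hn.le
      field_simp
      nlinarith [hsq]
    calc (nR k)⁻¹ ^ 13 * (nR k ^ 96)⁻¹ ^ 3 * (1 + Real.log (2 * (((k + 1) ^ (2 : ℕ) : ℕ) : ℝ) + 1))
        ≤ (nR k)⁻¹ ^ 13 * (nR k ^ 96)⁻¹ ^ 3 * (7 * Real.sqrt (nR k)) :=
          mul_le_mul_of_nonneg_left hl (by positivity)
      _ = 7 * Q := e
  have t2 : (wilsonMeasure u1Rep (nR k ^ 96) : Measure (GaugeConfig 4 (2 * (k + 1) ^ (2 : ℕ) + 1) Circle)).real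
      {U | ∀ p : Plaquette 4 (2 * (k + 1) ^ (2 : ℕ) + 1), |plaqAngle U p| < epsW k}ᶜ ≤ Q := by
    refine hη.trans ?_
    rw [hQ, show nR k ^ 312 = nR k ^ 300 * nR k ^ 12 by ring, mul_inv]
    exact mul_le_mul_of_nonneg_left (hs 12 (by norm_num)) (by positivity)
  have t3 : epsW k ^ 8 ≤ Q := by
    unfold epsW
    rw [inv_pow, ← pow_mul, hQ, show nR k ^ (43 * 8) = nR k ^ 300 * nR k ^ 44 by ring, mul_inv]
    exact mul_le_mul_of_nonneg_left (hs 44 (by norm_num)) (by positivity)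
  have t4 : (nR k ^ 96)⁻¹ ^ 3 * (nR k ^ 96 * Fintype.card (Plaquette 4 (2 * (k + 1) ^ (2 : ℕ) + 1)) * epsW k ^ 4 +
      Fintype.card (Plaquette 4 (2 * (k + 1) ^ (2 : ℕ) + 1)) * (epsW k * Real.sqrt (nR k ^ 96))⁻¹ ^ 6) ≤ 972 * Q := by
    have hw := beta_card_eps_four_le k
    have hτ' := card_tail_le k
    have hs2 : nR k ^ 96 * Fintype.card (Plaquette 4 (2 * (k + 1) ^ (2 : ℕ) + 1)) * epsW k ^ 4 +
        Fintype.card (Plaquette 4 (2 * (k + 1) ^ (2 : ℕ) + 1)) * (epsW k * Real.sqrt (nR k ^ 96))⁻¹ ^ 6 ≤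
        972 * (nR k ^ 22)⁻¹ := by
      have : (nR k ^ 68)⁻¹ ≤ (nR k ^ 22)⁻¹ := inv_anti₀ (pow_pos hn _) (pow_le_pow_right₀ hn1 (by norm_num))
      linarith
    calc (nR k ^ 96)⁻¹ ^ 3 * (nR k ^ 96 * Fintype.card (Plaquette 4 (2 * (k + 1) ^ (2 : ℕ) + 1)) * epsW k ^ 4 +
          Fintype.card (Plaquette 4 (2 * (k + 1) ^ (2 : ℕ) + 1)) * (epsW k * Real.sqrt (nR k ^ 96))⁻¹ ^ 6)
        ≤ (nR k ^ 96)⁻¹ ^ 3 * (972 * (nR k ^ 22)⁻¹) := mul_le_mul_of_nonneg_left hs2 (by positivity)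
      _ = 972 * ((nR k ^ 300)⁻¹ * (nR k ^ 10)⁻¹) := by field_simp
      _ ≤ 972 * Q := by
          rw [hQ]
          exact mul_le_mul_of_nonneg_left (mul_le_mul_of_nonneg_left (hs 10 (by norm_num)) (by positivity))
            (by norm_num)
  have e : 981 * K * ((nR k ^ 300)⁻¹ * (Real.sqrt (nR k))⁻¹) = K * (7 * Q + Q + Q + 972 * Q) := by rw [hQ]; ring
  rw [e]
  exact mul_le_mul_of_nonneg_left (by linarith) hK0

/-! ### The self-normalised cumulant tends to zero -/

/-- `(√n)⁻¹ → 0` along the scheme. [folklore] -/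
theorem tendsto_inv_sqrt_nR : Tendsto (fun k => (Real.sqrt (nR k))⁻¹) atTop (𝓝 0) :=
  tendsto_inv_atTop_zero.comp (Real.tendsto_sqrt_atTop.comp tendsto_nR)

/-- **`κ₃^canon_k(f,g,h) → 0` along the `U(1)` witness**, for every pairwise disjoint Schwartz triple.
[folklore] -/
theorem cruxKappa3_witness_tendsto (f g h : SchwartzMap E4 ℝ) (hfg : Disjoint (tsupport f) (tsupport g))
    (hfh : Disjoint (tsupport f) (tsupport h)) (hgh : Disjoint (tsupport g) (tsupport h)) :
    Tendsto (cruxKappa3 u1LatticeRep (swScheme 96) bumpU f g h) atTop (𝓝 0) := by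
  obtain ⟨K, hK0, hM⟩ := cm3_witness_eventually f g h hfg hfh hgh
  obtain ⟨c, hc0, hT⟩ := cruxT_lower_eventually bumpU tsupport_bumpU_subset_neg bumpU_nonneg (t₀ := 2)
    (by linarith [bumpR_le_tpDelta, tpDelta_spec.1]) (fun y hy => one_le_bumpU hy)
  rw [tendsto_zero_iff_abs_tendsto_zero]
  have hB : Tendsto (fun k => (Real.sqrt c)⁻¹ ^ 3 * K * (Real.sqrt (nR k))⁻¹) atTop (𝓝 0) := by
    simpa only [mul_zero] using tendsto_inv_sqrt_nR.const_mul ((Real.sqrt c)⁻¹ ^ 3 * K)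
  refine squeeze_zero' (Eventually.of_forall fun k => abs_nonneg _) ?_ hB
  filter_upwards [hM, hT] with k hMk hTk
  have hn := nR_pos k
  have hTpos : 0 < cruxT u1LatticeRep (swScheme 96) bumpU k := lt_of_lt_of_le (by positivity) hTk
  show |cruxKappa3 u1LatticeRep (swScheme 96) bumpU f g h k| ≤ _
  rw [cruxKappa3_witness_eq, abs_mul]
  -- the normalisation
  have hnorm : |(Real.sqrt (cruxT u1LatticeRep (swScheme 96) bumpU k))⁻¹ ^ 3| ≤
      (Real.sqrt c)⁻¹ ^ 3 * nR k ^ 300 := by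
    rw [abs_of_nonneg (by positivity)]
    have h1 : Real.sqrt (c * (nR k ^ 200)⁻¹) ≤ Real.sqrt (cruxT u1LatticeRep (swScheme 96) bumpU k) :=
      Real.sqrt_le_sqrt hTk
    have h2 : Real.sqrt (c * (nR k ^ 200)⁻¹) = Real.sqrt c * (nR k ^ 100)⁻¹ := by
      rw [Real.sqrt_mul hc0.le, Real.sqrt_inv, show nR k ^ 200 = (nR k ^ 100) ^ 2 by ring,
        Real.sqrt_sq (by positivity)]
    have h3 : (Real.sqrt (cruxT u1LatticeRep (swScheme 96) bumpU k))⁻¹ ≤ (Real.sqrt c)⁻¹ * nR k ^ 100 := by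
      have := inv_anti₀ (by rw [h2]; positivity) h1
      rw [h2, mul_inv, inv_inv] at this
      exact this
    calc (Real.sqrt (cruxT u1LatticeRep (swScheme 96) bumpU k))⁻¹ ^ 3 ≤ ((Real.sqrt c)⁻¹ * nR k ^ 100) ^ 3 :=
          pow_le_pow_left₀ (by positivity) h3 3
      _ = (Real.sqrt c)⁻¹ ^ 3 * nR k ^ 300 := by ring
  have hM' : |∫ U, (PhiW k f U - ∫ U', PhiW k f U' ∂(wilsonMeasure u1Rep (((k : ℝ) + 1) ^ 96) :
              Measure (GaugeConfig 4 (2 * (k + 1) ^ 2 + 1) Circle))) *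
            (PhiW k g U - ∫ U', PhiW k g U' ∂(wilsonMeasure u1Rep (((k : ℝ) + 1) ^ 96) :
              Measure (GaugeConfig 4 (2 * (k + 1) ^ 2 + 1) Circle))) *
            (PhiW k h U - ∫ U', PhiW k h U' ∂(wilsonMeasure u1Rep (((k : ℝ) + 1) ^ 96) :
              Measure (GaugeConfig 4 (2 * (k + 1) ^ 2 + 1) Circle)))
          ∂(wilsonMeasure u1Rep (((k : ℝ) + 1) ^ 96) : Measure (GaugeConfig 4 (2 * (k + 1) ^ 2 + 1) Circle))| ≤
        K * ((nR k ^ 300)⁻¹ * (Real.sqrt (nR k))⁻¹) := hMk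
  calc |(Real.sqrt (cruxT u1LatticeRep (swScheme 96) bumpU k))⁻¹ ^ 3| * _
      ≤ ((Real.sqrt c)⁻¹ ^ 3 * nR k ^ 300) * (K * ((nR k ^ 300)⁻¹ * (Real.sqrt (nR k))⁻¹)) :=
        mul_le_mul hnorm hM' (abs_nonneg _) (by positivity)
    _ = (Real.sqrt c)⁻¹ ^ 3 * K * (Real.sqrt (nR k))⁻¹ := by field_simp

/-! ### Floor and window -/

/-- **Floor and window of the crux along the witness**: eventually `a_k^{201} ≤ T_k(u) ≤ M · T_k(τ₋₁u)`.
[folklore] -/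
theorem floor_window_eventually : ∃ M : ℝ, ∀ᶠ k in atTop,
    (swScheme 96).a k ^ 201 ≤ cruxT u1LatticeRep (swScheme 96) bumpU k ∧
      cruxT u1LatticeRep (swScheme 96) bumpU k ≤ M * cruxT u1LatticeRep (swScheme 96) (timeShiftTest 4 (-1) bumpU) k := by
  obtain ⟨c, hc0, hlow⟩ := cruxT_lower_eventually bumpU tsupport_bumpU_subset_neg bumpU_nonneg (t₀ := 2)
    (by linarith [bumpR_le_tpDelta, tpDelta_spec.1]) (fun y hy => one_le_bumpU hy)
  obtain ⟨cτ, hcτ0, hlowτ⟩ := cruxT_lower_eventually (timeShiftTest 4 (-1) bumpU) tsupport_shiftU_subset_neg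
    shiftU_nonneg (t₀ := 3) (by linarith [bumpR_le_tpDelta, tpDelta_spec.1]) (fun y hy => one_le_shiftU hy)
  obtain ⟨C, hC0, hup⟩ := cruxT_upper_eventually
  refine ⟨C / cτ, ?_⟩
  filter_upwards [hlow, hlowτ, hup, eventually_const_mul_inv_pow_le 1 (m := 1) le_rfl hc0] with k h1 h2 h3 h4
  have hn := nR_pos k
  constructor
  · -- floor: `a^201 = n^{-201} ≤ c n^{-200}`
    have e : (swScheme 96).a k ^ 201 = (nR k ^ 1)⁻¹ * (nR k ^ 200)⁻¹ := by
      rw [swScheme_a, show ((k : ℝ) + 1) = nR k from rfl, ← mul_inv, ← pow_add, inv_pow]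
    rw [e]
    refine le_trans ?_ h1
    rw [one_mul] at h4
    exact mul_le_mul_of_nonneg_right h4 (by positivity)
  · -- window
    calc cruxT u1LatticeRep (swScheme 96) bumpU k ≤ C * (nR k ^ 200)⁻¹ := h3
      _ = C / cτ * (cτ * (nR k ^ 200)⁻¹) := by field_simp
      _ ≤ C / cτ * cruxT u1LatticeRep (swScheme 96) (timeShiftTest 4 (-1) bumpU) k :=
          mul_le_mul_of_nonneg_left h2 (by positivity)

/-! ### The witness inhabits `H`, and the crux falls -/

/-- **The `U(1)` super-weak witness is a Maxwell-dominated window scheme** (the hypothesis `H` of the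
disprover's negative lemma, now inhabited): `(Circle, u1LatticeRep, swScheme 96, bumpU, 201, M)`. [folklore] -/
theorem maxwellDominatedWindowScheme_holds : MaxwellDominatedWindowScheme := by
  obtain ⟨M, hM⟩ := floor_window_eventually
  refine ⟨Circle, inferInstance, inferInstance, inferInstance, inferInstance, inferInstance, inferInstance,
    u1LatticeRep, swScheme 96, bumpU, 201, M, ?_, ?_, tsupport_bumpU_subset_neg, hM, ?_⟩
  · -- weak coupling: `β_k = (k+1)^96 → ∞`
    show Tendsto (swScheme 96).β atTop atTop
    have : (swScheme 96).β = fun k => nR k ^ 96 := funext fun k => rfl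
    rw [this]
    exact (tendsto_pow_atTop (by norm_num)).comp tendsto_nR
  · -- polynomial volumes with `N = 1`
    refine ⟨1, le_rfl, Eventually.of_forall fun k => ?_⟩
    rw [pow_one, swScheme_a, swScheme_L]
    push_cast
    rw [inv_inv, show ((k : ℝ) + 1)⁻¹ * ((k : ℝ) + 1) ^ 2 = (k : ℝ) + 1 by field_simp]
  · intro f g h hfg hfh hgh
    rw [maxwellSkewRatio_eq_zero]
    exact cruxKappa3_witness_tendsto f g h hfg hfh hgh

/-- **`SelfNormalisedSkewness` (W₂ of route `ScalingWindowSplit`) is false as typed**: the group-blind,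
gap-free `∀`-statement fails at `G = U(1)` along the super-weak scheme `β_k = (k+1)^{96}`, `a_k = 1/(k+1)`,
`L_k = (k+1)²`, where every hypothesis holds and the self-normalised skewness of `tr F²` tends to `0`.
Class: refuted-misstated; repair `C′`: `… → sch.HasWeakCouplingLimit → 0 < Δ → HasLatticeMassGap r sch Δ → …`
(the witness is gapless in physical units). [folklore] -/
theorem not_SelfNormalisedSkewness :
    ¬ Summit.QuantumFields.YangMills.Theses.ScalingWindowSplit.SelfNormalisedSkewness :=
  SelfNormalisedSkewness_false_of_MaxwellDominatedWindowScheme maxwellDominatedWindowScheme_holds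

end Summit.QuantumFields.YangMills.Theorems.SelfNormalisedSkewness.Negative

end
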